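import Summits.QuantumFields.YangMills.Theorems.BalabanUVNodesN19TargetClassWeightsE1Keyed
import Literature.MathematicalPhysics.QuantumFieldTheory.Balaban1983to89.Node00.Record13CoreAtTheta13LiveOfRecord
import Literature.MathematicalPhysics.QuantumFieldTheory.Balaban1983to89.Node00.Record13NumericsOfThm1CCMW

/-!
# BalabanUVNodes ∕ N19 (NE7) — node U5's :183 road for keyed class-weight term data AT EVERY ₁₃ LIVE WITNESS CARRYING K0b's RESIDUALS (the all-numerics witness
# family, the Stage-13 witness of record `theta13LiveOfRecord F N`, the windowed collared K0⁷ witness `theta13OfThm1CCMW`): EVERY LAW BINDER DISCHARGED —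
# N19's face there displays only run ∕ key bookkeeping and the four spine ESTIMATES

Cell `pub-ymgap` (HUMAN RULING D-0062, Track A), R134 seat `pub-ymgap-dag-n19-d` (gen 15), strategy s2 «by-name knit»; lane = dag-lead g11 LANE WORD l.21525 (the MGF road's
AT-RECORD seat).  Filed `--kind proof --supports stmt-QuantumFields-20544 --as helper` (K3⁷ `SpineGivenEndpointR13SepCoPH`); COUNT-NEUTRAL.  Sibling of modules B′
`…N19MGFFormAtRecordMass` (p549768 ∕ p551256), B″ `…N19TargetClassWeightsE1` (p553397) and B‴ `…N19TargetClassWeightsE1Keyed` (p562886).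
[III] = [Balaban1988Convergent], [LF-I] = [Balaban1989LargeFieldI], [LF-II] = [Balaban1989LargeFieldII].

WHY THIS FILE.  Modules B′ §4 ∕ §6, B″ §2 and B‴ §1 ∕ §2 state N19's E1 ∕ E2 identities and its :183 road (∃δ-edge form) for term data read off NODE 00's dressed class
weights at a GENERAL Stage-9 tuple `ϑ` (or a general v1.7 parameter `θ : Stage13HParams` with `h : θ.Provisos₁₃CoPH F N`), and therefore DISPLAY the laws the dressed
family needs: the live-selector pin `hsel`, (H-U) `LocalBgMeasurable ϑ.ν`, (H-ζ) `ZetaMeasurable ϑ.ζ`, `0 ≤ ζ`, `IsZetaAbsLeOne`, `IsZetaUnity` (and, at the record, the proviso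
key `h`).  AT EVERY ₁₃ LIVE RE-PIN `θ.liveRepin₁₃ F N` (node00-def-K0a FILE 8 `Node00/Record13LiveSelector`) OF A STAGE-13 PARAMETER CARRYING K0b's RESIDUALS OF RECORD
(`hres : θ.HasResidualsOfRecord F N` — `θ.ζ` is the (3.16) factor `zeta316OfRecord`, `θ.Rz` ∕ `θ.Zt` are of record) EVERY ONE OF THEM IS A THEOREM of the tree: (H-U) is
node00-def-K0c's ABSOLUTE `localBgMeasurable` (`Node00/Record12MeasurabilityAbsolute`, hypothesis-free for every numerics); (H-ζ), `0 ≤ ζ`, `IsZetaAbsLeOne`, `IsZetaUnity`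
are K0b's ∕ K0c's laws of the (3.16) factor (`zetaMeasurable_zeta316OfRecord_of_localBg`, `zeta316OfRecord_nonneg`, `HasResidualsOfRecord.zetaAbs ∕ .zetaUnity`); the live
pin is `Stage13Params.liveRepin₁₃_ppSel` (`rfl`); and the v1.7 core provisos hold at the history-blind cured door `Stage13HParams.ofHistoryBlind F N (Stage13RParams.ofCured
F N (θ.liveRepin₁₃ F N))` by K0a FILE 12a `provisos₁₃Core_liveRepin₁₃_of_hasResiduals` ∘ FILE 18 `.ofCured` ∘ def-T FILE 27 `.ofHistoryBlind` — packaged HYPOTHESIS-FREE at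
the witness of record by dag-n11-e (`Node00/Record13CoreAtTheta13LiveOfRecord`, `provisos₁₃CoPH_door_theta13LiveOfRecord`, 2026-08-27).  Every Stage-13 witness the cell
has built is such a re-pin with `hres := ⟨rfl, rfl, rfl⟩`: K0a's all-numerics family `theta13LiveOfNumerics F N n ε₂₉ (zeta316OfRecord …) (RzOfRecord F N) (ZtOfRecord F N)`
(FILE 9), the witness of record `theta13LiveOfRecord F N` (its member `(1, ⅛)`), and dag-n21-c's windowed collared K0⁷ witness `theta13OfThm1CCMW F N j γ ε₀ ε₂₉ B₃ B₃' a₀ a₁`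
(`Node00/Record13NumericsOfThm1CCMW`, the witness of plan g77's LIVE skeleton V16).  Hence AT ALL OF THEM N19's class-weight faces display NO law, row, selector or proviso
binder: what remains is run ∕ key bookkeeping (`pA pB gA gB`, cutoffs `K₀ + K` ∕ `K₀ + K + 1`, histories starting at the dressing's coupling, node U5d's two key maps
`kA` ∕ `kB`) and EXACTLY THE FOUR SPINE ESTIMATES — N20's `RelWeightBound` (`h20`), N21's `ShellWeightBound` (`h21`), U4′'s `W + Wsh < 1` (`hlt`) and N19's own ∃δ-edge
`∃ δ, NE7.Core … δ ∧ Summable δ` (`hedge`; NOT PRINTED for `d = 4`).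

CONTENT (theorems only):
* §1 AT ANY ₁₃ LIVE RE-PIN CARRYING K0b's RESIDUALS (`θ`, `hres`): `zeta_liveRepin₁₃_nonneg_of_hasResiduals` · `zetaMeasurable_liveRepin₁₃_of_hasResiduals` (the laws);
  ★ `sum_classWeightOfDatum₉_liveRepin₁₃_eq_schemeZ` (E1 at every level `k ≤ K`, ANY datum with measurable averaging; binder `hres` only) ·
  `sum_fiberwise_classWeightOfDatum₉_liveRepin₁₃_eq_schemeZ` (the E2 shape) · ★★ `matching_scheme_of_coreEdge_keyedClassWeights_imageUnion_liveRepin₁₃` (B‴ §1's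
  :183 road: binders = `hres`, `D hD g₀ os`, runs + cutoffs + history starts, `kA kB`, `l₀ vol`, `h20 h21 hlt hedge` — nothing else) · `sum_classWeightOfDatum₉_liveRepin₁₃_door_eq_schemeZ`
  and ★★ `matching_datumOfRecord₁₃CoPH_liveRepin₁₃_door_of_coreEdge_keyedClassWeights_imageUnion` (B‴ §2 at the re-pin's OWN v1.7 datum through the history-blind cured
  door, for ANY proof `h` of the door's core provisos — inhabited by `(Stage13Params.provisos₁₃Core_liveRepin₁₃_of_hasResiduals hres).ofCured.ofHistoryBlind`; `hsel` ∕
  `hU` ∕ `hζm` ∕ `hζ0` discharged).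
* §2 AT K0a's ALL-NUMERICS WITNESS FAMILY (any `n : Stage12Numerics`, any `ε₂₉`): `sum_classWeightOfDatum₉_theta13LiveOfNumerics_eq_schemeZ` — HYPOTHESIS-FREE E1.
* §3 AT THE WITNESS OF RECORD `theta13LiveOfRecord F N`: ★ `sum_classWeightOfDatum₉_theta13LiveOfRecord_eq_schemeZ` · ★★ `matching_scheme_of_coreEdge_keyedClassWeights_imageUnion_theta13LiveOfRecord`
  (generic datum) · `sum_classWeightOfDatum₉_theta13LiveOfRecord_door_eq_schemeZ` (at NODE 00's CLOSED v1.7 datum of record, dag-n11-e's door proof) — all HYPOTHESIS-FREE in the laws.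
* §4 AT dag-n21-c's WINDOWED COLLARED K0⁷ WITNESS `theta13OfThm1CCMW F N j γ ε₀ ε₂₉ B₃ B₃' a₀ a₁`: ★ `sum_classWeightOfDatum₉_theta13OfThm1CCMW_eq_schemeZ` · ★★
  `matching_scheme_of_coreEdge_keyedClassWeights_imageUnion_theta13OfThm1CCMW` — HYPOTHESIS-FREE in the laws (no `n.Pos`, no window sign, no proviso is read).

HONEST FRAMING.  Count-neutral kernel bookkeeping: displayed-law binders that are theorems at every ₁₃ live witness carrying K0b's residuals are removed from N19's
class-weight faces (the A2 ∕ E3 referee notes on B″ READ-101: the faces' law binders are inhabited BY NAME at the witnesses; their ESTIMATE binders `h20` ∕ `h21` ∕ `hlt` ∕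
`hedge` are untouched and are the nodes' ∕ NE7's content).  It proves NO estimate: NE7 ∕ NE7b ∕ NE7c are NOT PRINTED for `d = 4` and NOT proved here; nothing of Bałaban's is
asserted; N19 is NOT discharged; no K-item closes; counts unmoved (typed 28∕28 · discharged 5∕27).  One finite `𝕋⁴_{L^K}` programme at fixed `ε = L^{−K}` along two
consecutive cutoffs; NOT ℝ⁴, NOT OS, NOT a mass gap, NOT Clay.  No `instance`, no `notation`, no `def` (theorems only).
Sources (bookkeeping locators): [III] (2.18) p.257, (3.16) p.268, (3.20)–(3.22) p.269, (3.24)–(3.25) p.270; [LF-I] (0.3)–(0.4) p.176, p.177 (i)–(ii); [LF-II] Thm 1 + (0.1)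
pp.355–356; [Balaban1985UV3] (6) p.257; [King1986] (3.10) p.656; [Balaban1987RG1] Thm 1 p.255 (the window letter `γ` of §4's witness).
-/

noncomputable section

namespace Summit.QuantumFields.YangMills.BalabanUVNodes.N19TargetClassWeightsAtLiveRecord

open MeasureTheory
open scoped BigOperators Matrix.Norms.L2Operator
open Literature.MathematicalPhysics.QuantumFieldTheory.Balaban1983to89
open Literature.MathematicalPhysics.QuantumFieldTheory.Balaban1983to89.Node00
open T4Continuum B14.Eq218Concrete
open T4WeightBudget (RelWeightBound)
open T4IndicatorShell (ShellWeightBound)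
open T4CauchySum (MatchingModConstants)
open Summit.QuantumFields.BalabanUV.T4Continuum.Spine
open Summit.QuantumFields.YangMills.BalabanUVNodes.N19MGFFormAtRecordMass
open Summit.QuantumFields.YangMills.BalabanUVNodes.N19TargetClassWeightsE1Keyed

variable (F : T4Family) (N : ℕ) [NeZero N]

/-! ## §1 AT ANY ₁₃ LIVE RE-PIN `θ.liveRepin₁₃ F N` OF A STAGE-13 PARAMETER CARRYING K0b's RESIDUALS: the laws are theorems, so E1 ∕ E2 and the :183 road display none -/

section LiveRepin

variable (θ : Stage13Params F N)

/-- **`0 ≤ ζ` at the re-pin** (`θ.ζ` is the (3.16) factor of record: K0b `zeta316OfRecord_nonneg`; the re-pin keeps `ζ`, `rfl`). [cite: Balaban1988Convergent, (3.16) p.268; Balaban1989LargeFieldI, (0.3) p.176 (bookkeeping)] -/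
theorem zeta_liveRepin₁₃_nonneg_of_hasResiduals (hres : θ.HasResidualsOfRecord F N) :
    ∀ p g k s Pl Ql RS U V', 0 ≤ (θ.liveRepin₁₃ F N).ζ p g k s Pl Ql RS U V' := by
  rw [Stage13Params.liveRepin₁₃_ζ, hres.zeta_eq]
  exact fun p g k s Pl Ql RS U V' => zeta316OfRecord_nonneg θ.A₁ p g k s Pl Ql RS U V'

/-- **(H-ζ) at the re-pin**: the residual `ζ` of record is jointly measurable — K0c's (H-ζ)-from-(H-U) `zetaMeasurable_zeta316OfRecord_of_localBg` over K0c's ABSOLUTE (H-U)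
`localBgMeasurable`. [cite: Balaban1988Convergent, (3.16) p.268, (3.2) p.265; Balaban1989LargeFieldI, (0.3) p.176 (bookkeeping)] -/
theorem zetaMeasurable_liveRepin₁₃_of_hasResiduals (hres : θ.HasResidualsOfRecord F N) : ZetaMeasurable F N (θ.liveRepin₁₃ F N).ζ := by
  rw [Stage13Params.liveRepin₁₃_ζ, hres.zeta_eq]
  exact zetaMeasurable_zeta316OfRecord_of_localBg (localBgMeasurable F N θ.ν) θ.τ9.M θ.A₁

/-- **★ E1 AT EVERY LEVEL AT THE RE-PIN — binder `hres` only**: for ANY datum `D` with measurable averaging, any run `p` whose coupling history starts at the dressing's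
coupling (`g 0 = g₀ K`) and every `k ≤ K`, `Σ_s classWeightOfDatum₉ (θ.liveRepin₁₃ F N).toStage9Params D g₀ os p g k t s = schemeZ (D.scheme g₀) os K t` — module B′ §2
`sum_classWeightOfDatum₉_eq_schemeZ_of_ppSelLive_of_localBg` with the pin := `liveRepin₁₃_ppSel` (`rfl`), (H-U) := K0c, (H-ζ) ∕ `0 ≤ ζ` := the two lemmas above,
`IsZetaAbsLeOne` ∕ `IsZetaUnity` := `(HasResidualsOfRecord.liveRepin₁₃ hres).zetaAbs ∕ .zetaUnity`. [cite: Balaban1985UV3, (6) p.257; King1986, (3.10) p.656; Balaban1988Convergent, (3.16) p.268, (3.24)–(3.25) p.270; Balaban1989LargeFieldI, (0.3)–(0.4) p.176 (bookkeeping)] -/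
theorem sum_classWeightOfDatum₉_liveRepin₁₃_eq_schemeZ (hres : θ.HasResidualsOfRecord F N) (D : FiniteEpsData F (SU N)) (hD : D.AvgMeasurable)
    (g₀ : ℕ → ℝ) (os : List (ULoop F)) (p : B12.RunParams) (g : ℕ → ℝ) (hg : g 0 = g₀ p.K) (t : ℝ) (k : ℕ) (hk : k ≤ p.K) :
    ∑ s : SeqOfRecord F θ.ν θ.τ9.M g p.K k, classWeightOfDatum₉ F N (θ.liveRepin₁₃ F N).toStage9Params D g₀ os p g k t s
      = T4GenFunBounds.schemeZ (D.scheme g₀) os p.K t :=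
  sum_classWeightOfDatum₉_eq_schemeZ_of_ppSelLive_of_localBg (θ.liveRepin₁₃ F N).toStage9Params (EOfRecord₁₃ F N θ)
    (Stage13Params.liveRepin₁₃_ppSel F N θ) hg (localBgMeasurable F N _) (zetaMeasurable_liveRepin₁₃_of_hasResiduals F N θ hres)
    (zeta_liveRepin₁₃_nonneg_of_hasResiduals F N θ hres) (Stage13Params.HasResidualsOfRecord.liveRepin₁₃ hres).zetaAbs
    (Stage13Params.HasResidualsOfRecord.liveRepin₁₃ hres).zetaUnity D hD os t k hk

/-- **E1 AT EVERY LEVEL AT THE RE-PIN, SUMMED FIBREWISE** along any map `tr` of the sequences of record into a finite class set `T` (the E2 shape of a two-run reading;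
`k ≤ K`; binder `hres` only). [cite: Balaban1985UV3, (6) p.257; King1986, (3.10) p.656; Balaban1988Convergent, (2.18) p.257 (bookkeeping)] -/
theorem sum_fiberwise_classWeightOfDatum₉_liveRepin₁₃_eq_schemeZ {ι : Type*} [DecidableEq ι] (hres : θ.HasResidualsOfRecord F N)
    (D : FiniteEpsData F (SU N)) (hD : D.AvgMeasurable) (g₀ : ℕ → ℝ) (os : List (ULoop F)) (p : B12.RunParams) (g : ℕ → ℝ) (hg : g 0 = g₀ p.K)
    (t : ℝ) (k : ℕ) (hk : k ≤ p.K) (T : Finset ι) (tr : SeqOfRecord F θ.ν θ.τ9.M g p.K k → ι) (htr : ∀ s, tr s ∈ T) :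
    ∑ τ ∈ T, ∑ s ∈ Finset.univ.filter (fun s : SeqOfRecord F θ.ν θ.τ9.M g p.K k => tr s = τ),
        classWeightOfDatum₉ F N (θ.liveRepin₁₃ F N).toStage9Params D g₀ os p g k t s
      = T4GenFunBounds.schemeZ (D.scheme g₀) os p.K t := by
  rw [Finset.sum_fiberwise_of_maps_to (s := Finset.univ) (t := T) (g := tr) (fun s _ => htr s)]
  exact sum_classWeightOfDatum₉_liveRepin₁₃_eq_schemeZ F N θ hres D hD g₀ os p g hg t k hk

variable {ι : Type} [DecidableEq ι]

/-- **★★ N19's :183 ROAD (∃δ-EDGE FORM) FOR TWO-SIDED KEYED CLASS-WEIGHT TERM DATA AT THE RE-PIN, EVERY LAW DISCHARGED.**  At ANY datum `D` with measurable averaging, for runs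
`pA K` ∕ `pB K` at cutoffs `K₀ + K` ∕ `K₀ + K + 1` whose histories start at the dressing's coupling and ANY key maps `kA K` ∕ `kB K` of the two runs' sequences of record (at
`θ`'s numerics) into a common index type `ι` (node U5d's «block down, then key»; class set `univ.image (kA K) ∪ univ.image (kB K)` built in-file): N20's `RelWeightBound`,
N21's `ShellWeightBound`, U4′'s `W + Wsh < 1` and N19's ∃δ-edge FOR THE KEYED TERM DATA (the two fibre sums of NODE 00's dressed class weights at the re-pin) ⇒
`∃ δ′, Summable δ′ ∧ MatchingModConstants vol l₀ δ′ (schemeZ (D.scheme g₀) os)`.  Module B‴ §1 `matching_scheme_of_coreEdge_keyedClassWeights_imageUnion` at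
`ϑ := (θ.liveRepin₁₃ F N).toStage9Params` with `hsel` ∕ `hU` ∕ `hζm` ∕ `hζ0` ∕ `hζ1` ∕ `hζu` DISCHARGED.  DISPLAYED: `hres`, bookkeeping and the four ESTIMATES only.
[cite: Balaban1985UV3, (6) p.257; Balaban1989LargeFieldII, Thm 1 + (0.1) pp.355–356; King1986, (3.10) p.656; Balaban1989LargeFieldI, (0.3)–(0.4) p.176 (bookkeeping)] -/
theorem matching_scheme_of_coreEdge_keyedClassWeights_imageUnion_liveRepin₁₃ (hres : θ.HasResidualsOfRecord F N)
    (D : FiniteEpsData F (SU N)) (hD : D.AvgMeasurable) (g₀ : ℕ → ℝ) (os : List (ULoop F)) {K₀ : ℕ} (pA pB : ℕ → B12.RunParams) (gA gB : ℕ → ℕ → ℝ)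
    (hKA : ∀ K, (pA K).K = K₀ + K) (hKB : ∀ K, (pB K).K = K₀ + K + 1) (hgA : ∀ K, gA K 0 = g₀ (pA K).K) (hgB : ∀ K, gB K 0 = g₀ (pB K).K)
    (kA : (K : ℕ) → SeqOfRecord F θ.ν θ.τ9.M (gA K) (pA K).K (pA K).K → ι) (kB : (K : ℕ) → SeqOfRecord F θ.ν θ.τ9.M (gB K) (pB K).K (pB K).K → ι)
    {l₀ vol : ℝ} (hl₀ : 0 ≤ l₀) (hvol : 0 < vol) {shA shB : ℕ → ℝ → ι → ℝ} {Bad : ℕ → ℝ → Finset ι} {W Wsh : ℕ → ℝ}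
    (h20 : RelWeightBound l₀ (fun K => Finset.univ.image (kA K) ∪ Finset.univ.image (kB K))
      (fun K t x => ∑ s ∈ Finset.univ.filter (fun s : SeqOfRecord F θ.ν θ.τ9.M (gA K) (pA K).K (pA K).K => kA K s = x),
        classWeightOfDatum₉ F N (θ.liveRepin₁₃ F N).toStage9Params D g₀ os (pA K) (gA K) (pA K).K t s)
      (fun K t x => ∑ s' ∈ Finset.univ.filter (fun s' : SeqOfRecord F θ.ν θ.τ9.M (gB K) (pB K).K (pB K).K => kB K s' = x),
        classWeightOfDatum₉ F N (θ.liveRepin₁₃ F N).toStage9Params D g₀ os (pB K) (gB K) (pB K).K t s') Bad W)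
    (h21 : ShellWeightBound l₀ (fun K => Finset.univ.image (kA K) ∪ Finset.univ.image (kB K))
      (fun K t x => ∑ s ∈ Finset.univ.filter (fun s : SeqOfRecord F θ.ν θ.τ9.M (gA K) (pA K).K (pA K).K => kA K s = x),
        classWeightOfDatum₉ F N (θ.liveRepin₁₃ F N).toStage9Params D g₀ os (pA K) (gA K) (pA K).K t s)
      (fun K t x => ∑ s' ∈ Finset.univ.filter (fun s' : SeqOfRecord F θ.ν θ.τ9.M (gB K) (pB K).K (pB K).K => kB K s' = x),
        classWeightOfDatum₉ F N (θ.liveRepin₁₃ F N).toStage9Params D g₀ os (pB K) (gB K) (pB K).K t s') shA shB Wsh)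
    (hlt : ∀ K, W K + Wsh K < 1)
    (hedge : ∃ δ : ℕ → ℝ, NE7.Core l₀ vol (fun K => Finset.univ.image (kA K) ∪ Finset.univ.image (kB K)) Bad
      (fun K t x => (∑ s ∈ Finset.univ.filter (fun s : SeqOfRecord F θ.ν θ.τ9.M (gA K) (pA K).K (pA K).K => kA K s = x),
        classWeightOfDatum₉ F N (θ.liveRepin₁₃ F N).toStage9Params D g₀ os (pA K) (gA K) (pA K).K t s) - shA K t x)
      (fun K t x => (∑ s' ∈ Finset.univ.filter (fun s' : SeqOfRecord F θ.ν θ.τ9.M (gB K) (pB K).K (pB K).K => kB K s' = x),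
        classWeightOfDatum₉ F N (θ.liveRepin₁₃ F N).toStage9Params D g₀ os (pB K) (gB K) (pB K).K t s') - shB K t x) δ ∧ Summable δ) :
    ∃ δ' : ℕ → ℝ, Summable δ' ∧ MatchingModConstants vol l₀ δ' (T4GenFunBounds.schemeZ (D.scheme g₀) os) :=
  matching_scheme_of_coreEdge_keyedClassWeights_imageUnion (θ.liveRepin₁₃ F N).toStage9Params (EOfRecord₁₃ F N θ)
    (Stage13Params.liveRepin₁₃_ppSel F N θ) (localBgMeasurable F N _) (zetaMeasurable_liveRepin₁₃_of_hasResiduals F N θ hres)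
    (zeta_liveRepin₁₃_nonneg_of_hasResiduals F N θ hres) (Stage13Params.HasResidualsOfRecord.liveRepin₁₃ hres).zetaAbs
    (Stage13Params.HasResidualsOfRecord.liveRepin₁₃ hres).zetaUnity D hD g₀ os pA pB gA gB hKA hKB hgA hgB kA kB
    hl₀ hvol h20 h21 hlt hedge

/-- **E1 AT EVERY LEVEL AT THE RE-PIN'S OWN v1.7 DATUM** `𝔇 := datumOfRecord₁₃CoPH F N (ofHistoryBlind (ofCured (θ.liveRepin₁₃ F N))) h` through the history-blind cured door
(def-T FILE 27 ∕ K0a FILE 18), for ANY proof `h` of the door's core provisos — INHABITED, given `hres`, by `(Stage13Params.provisos₁₃Core_liveRepin₁₃_of_hasResiduals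
hres).ofCured.ofHistoryBlind` (K0a FILE 12a): `Σ_s classWeightOfDatum₉ (θ.liveRepin₁₃ F N).toStage9Params 𝔇 g₀ os p g k t s = schemeZ (𝔇.scheme g₀) os K t` (`k ≤ K`), the
datum's measurable averaging being B1 `isPrintedAveraged_datumOfRecord₁₃CoPH` BY NAME. [cite: Balaban1985UV3, (6) p.257; King1986, (3.10) p.656; Balaban1989LargeFieldII, Thm 1 + (0.1) pp.355–356 (bookkeeping)] -/
theorem sum_classWeightOfDatum₉_liveRepin₁₃_door_eq_schemeZ (hres : θ.HasResidualsOfRecord F N)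
    (h : (Stage13HParams.ofHistoryBlind F N (Stage13RParams.ofCured F N (θ.liveRepin₁₃ F N))).Provisos₁₃CoPH F N)
    (g₀ : ℕ → ℝ) (os : List (ULoop F)) (p : B12.RunParams) (g : ℕ → ℝ) (hg : g 0 = g₀ p.K) (t : ℝ) (k : ℕ) (hk : k ≤ p.K) :
    ∑ s : SeqOfRecord F θ.ν θ.τ9.M g p.K k,
        classWeightOfDatum₉ F N (θ.liveRepin₁₃ F N).toStage9Params
          (datumOfRecord₁₃CoPH F N (Stage13HParams.ofHistoryBlind F N (Stage13RParams.ofCured F N (θ.liveRepin₁₃ F N))) h) g₀ os p g k t s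
      = T4GenFunBounds.schemeZ ((datumOfRecord₁₃CoPH F N (Stage13HParams.ofHistoryBlind F N (Stage13RParams.ofCured F N (θ.liveRepin₁₃ F N))) h).scheme g₀) os p.K t :=
  sum_classWeightOfDatum₉_liveRepin₁₃_eq_schemeZ F N θ hres _ (isPrintedAveraged_datumOfRecord₁₃CoPH F N _ h).avgMeasurable g₀ os p g hg t k hk

/-- **★★ N19's :183 ROAD AT THE RE-PIN'S OWN v1.7 DATUM OF RECORD, EVERY LAW ∕ ROW ∕ SELECTOR BINDER DISCHARGED** — module B‴ §2
`matching_datumOfRecord₁₃CoPH_of_coreEdge_keyedClassWeights_imageUnion` at the history-blind cured door of `θ.liveRepin₁₃ F N` (its Stage-9 part IS the re-pin's, `rfl`), for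
ANY proof `h` of the door's core provisos (inhabited by `(Stage13Params.provisos₁₃Core_liveRepin₁₃_of_hasResiduals hres).ofCured.ofHistoryBlind`); `hsel` ∕ `hU` ∕ `hζm` ∕
`hζ0` := §1.  What N19's face displays AT THE RECORD is therefore: `hres`, the two run families with their cutoffs and history starts, node U5d's two key maps, `0 ≤ l₀`,
`0 < vol`, and THE FOUR SPINE ESTIMATES `h20` (N20) ∕ `h21` (N21) ∕ `hlt` (U4′) ∕ `hedge` (NE7's ∃δ-edge, NOT PRINTED for `d = 4`) — nothing else.
[cite: Balaban1985UV3, (6) p.257; Balaban1989LargeFieldII, Thm 1 + (0.1) pp.355–356; King1986, (3.10) p.656 (bookkeeping)] -/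
theorem matching_datumOfRecord₁₃CoPH_liveRepin₁₃_door_of_coreEdge_keyedClassWeights_imageUnion (hres : θ.HasResidualsOfRecord F N)
    (h : (Stage13HParams.ofHistoryBlind F N (Stage13RParams.ofCured F N (θ.liveRepin₁₃ F N))).Provisos₁₃CoPH F N)
    (g₀ : ℕ → ℝ) (os : List (ULoop F)) {K₀ : ℕ} (pA pB : ℕ → B12.RunParams) (gA gB : ℕ → ℕ → ℝ)
    (hKA : ∀ K, (pA K).K = K₀ + K) (hKB : ∀ K, (pB K).K = K₀ + K + 1) (hgA : ∀ K, gA K 0 = g₀ (pA K).K) (hgB : ∀ K, gB K 0 = g₀ (pB K).K)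
    (kA : (K : ℕ) → SeqOfRecord F θ.ν θ.τ9.M (gA K) (pA K).K (pA K).K → ι) (kB : (K : ℕ) → SeqOfRecord F θ.ν θ.τ9.M (gB K) (pB K).K (pB K).K → ι)
    {l₀ vol : ℝ} (hl₀ : 0 ≤ l₀) (hvol : 0 < vol) {shA shB : ℕ → ℝ → ι → ℝ} {Bad : ℕ → ℝ → Finset ι} {W Wsh : ℕ → ℝ}
    (h20 : RelWeightBound l₀ (fun K => Finset.univ.image (kA K) ∪ Finset.univ.image (kB K))
      (fun K t x => ∑ s ∈ Finset.univ.filter (fun s : SeqOfRecord F θ.ν θ.τ9.M (gA K) (pA K).K (pA K).K => kA K s = x),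
        classWeightOfDatum₉ F N (θ.liveRepin₁₃ F N).toStage9Params
          (datumOfRecord₁₃CoPH F N (Stage13HParams.ofHistoryBlind F N (Stage13RParams.ofCured F N (θ.liveRepin₁₃ F N))) h) g₀ os (pA K) (gA K) (pA K).K t s)
      (fun K t x => ∑ s' ∈ Finset.univ.filter (fun s' : SeqOfRecord F θ.ν θ.τ9.M (gB K) (pB K).K (pB K).K => kB K s' = x),
        classWeightOfDatum₉ F N (θ.liveRepin₁₃ F N).toStage9Params
          (datumOfRecord₁₃CoPH F N (Stage13HParams.ofHistoryBlind F N (Stage13RParams.ofCured F N (θ.liveRepin₁₃ F N))) h) g₀ os (pB K) (gB K) (pB K).K t s') Bad W)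
    (h21 : ShellWeightBound l₀ (fun K => Finset.univ.image (kA K) ∪ Finset.univ.image (kB K))
      (fun K t x => ∑ s ∈ Finset.univ.filter (fun s : SeqOfRecord F θ.ν θ.τ9.M (gA K) (pA K).K (pA K).K => kA K s = x),
        classWeightOfDatum₉ F N (θ.liveRepin₁₃ F N).toStage9Params
          (datumOfRecord₁₃CoPH F N (Stage13HParams.ofHistoryBlind F N (Stage13RParams.ofCured F N (θ.liveRepin₁₃ F N))) h) g₀ os (pA K) (gA K) (pA K).K t s)
      (fun K t x => ∑ s' ∈ Finset.univ.filter (fun s' : SeqOfRecord F θ.ν θ.τ9.M (gB K) (pB K).K (pB K).K => kB K s' = x),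
        classWeightOfDatum₉ F N (θ.liveRepin₁₃ F N).toStage9Params
          (datumOfRecord₁₃CoPH F N (Stage13HParams.ofHistoryBlind F N (Stage13RParams.ofCured F N (θ.liveRepin₁₃ F N))) h) g₀ os (pB K) (gB K) (pB K).K t s') shA shB Wsh)
    (hlt : ∀ K, W K + Wsh K < 1)
    (hedge : ∃ δ : ℕ → ℝ, NE7.Core l₀ vol (fun K => Finset.univ.image (kA K) ∪ Finset.univ.image (kB K)) Bad
      (fun K t x => (∑ s ∈ Finset.univ.filter (fun s : SeqOfRecord F θ.ν θ.τ9.M (gA K) (pA K).K (pA K).K => kA K s = x),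
        classWeightOfDatum₉ F N (θ.liveRepin₁₃ F N).toStage9Params
          (datumOfRecord₁₃CoPH F N (Stage13HParams.ofHistoryBlind F N (Stage13RParams.ofCured F N (θ.liveRepin₁₃ F N))) h) g₀ os (pA K) (gA K) (pA K).K t s) - shA K t x)
      (fun K t x => (∑ s' ∈ Finset.univ.filter (fun s' : SeqOfRecord F θ.ν θ.τ9.M (gB K) (pB K).K (pB K).K => kB K s' = x),
        classWeightOfDatum₉ F N (θ.liveRepin₁₃ F N).toStage9Params
          (datumOfRecord₁₃CoPH F N (Stage13HParams.ofHistoryBlind F N (Stage13RParams.ofCured F N (θ.liveRepin₁₃ F N))) h) g₀ os (pB K) (gB K) (pB K).K t s') - shB K t x)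
        δ ∧ Summable δ) :
    ∃ δ' : ℕ → ℝ, Summable δ' ∧
      MatchingModConstants vol l₀ δ'
        (T4GenFunBounds.schemeZ ((datumOfRecord₁₃CoPH F N (Stage13HParams.ofHistoryBlind F N (Stage13RParams.ofCured F N (θ.liveRepin₁₃ F N))) h).scheme g₀) os) :=
  matching_scheme_of_coreEdge_keyedClassWeights_imageUnion_liveRepin₁₃ F N θ hres _ (isPrintedAveraged_datumOfRecord₁₃CoPH F N _ h).avgMeasurable
    g₀ os pA pB gA gB hKA hKB hgA hgB kA kB hl₀ hvol h20 h21 hlt hedge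

end LiveRepin

/-! ## §2 AT node00-def-K0a's ALL-NUMERICS WITNESS FAMILY `θ₁₃(n, ε₂₉) = theta13LiveOfNumerics F N n ε₂₉ (zeta316OfRecord …) (RzOfRecord F N) (ZtOfRecord F N)` (FILE 9;
every numerics re-pin of the K0 witness — in particular every `theta13OfThm1*` witness — is a member): `hres := ⟨rfl, rfl, rfl⟩`, so E1 is HYPOTHESIS-FREE -/

section AllNumerics

/-- **E1 AT EVERY LEVEL AT EVERY MEMBER OF THE ALL-NUMERICS WITNESS FAMILY — HYPOTHESIS-FREE** (no `n.Pos`, no proviso, no law binder): §1 at `θ := theta13OfNumerics F N n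
ε₂₉ …` (the member is its re-pin, `rfl`) with `hres := hasResidualsOfRecord_theta13OfNumerics`.  The :183 road at a member is §1's
`matching_scheme_of_coreEdge_keyedClassWeights_imageUnion_liveRepin₁₃ … (hasResidualsOfRecord_theta13OfNumerics F N n ε₂₉)` verbatim.
[cite: Balaban1985UV3, (6) p.257; King1986, (3.10) p.656; Balaban1988Convergent, (3.16) p.268, (3.24)–(3.25) p.270; Balaban1989LargeFieldI, (0.3)–(0.4) p.176 (bookkeeping)] -/
theorem sum_classWeightOfDatum₉_theta13LiveOfNumerics_eq_schemeZ (n : Stage12Numerics) (ε₂₉ : ℝ) (D : FiniteEpsData F (SU N)) (hD : D.AvgMeasurable)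
    (g₀ : ℕ → ℝ) (os : List (ULoop F)) (p : B12.RunParams) (g : ℕ → ℝ) (hg : g 0 = g₀ p.K) (t : ℝ) (k : ℕ) (hk : k ≤ p.K) :
    ∑ s : SeqOfRecord F n.ν n.τ9.M g p.K k,
        classWeightOfDatum₉ F N (theta13LiveOfNumerics F N n ε₂₉ (zeta316OfRecord F N n.ν n.τ9.M n.A₁) (RzOfRecord F N) (ZtOfRecord F N)).toStage9Params D g₀ os p g k t s
      = T4GenFunBounds.schemeZ (D.scheme g₀) os p.K t :=
  sum_classWeightOfDatum₉_liveRepin₁₃_eq_schemeZ F N (theta13OfNumerics F N n ε₂₉ _ _ _) (hasResidualsOfRecord_theta13OfNumerics F N n ε₂₉) D hD g₀ os p g hg t k hk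

end AllNumerics

/-! ## §3 AT THE STAGE-13 WITNESS OF RECORD `θ₁₃ = theta13LiveOfRecord F N` (the ₁₃ live re-pin of `theta13OfFamily F N eps0OfRecord₁₃ …` at K0b's residuals, `rfl`):
E1, the :183 road and E1 at NODE 00's CLOSED v1.7 datum of record (dag-n11-e's door proof) — all HYPOTHESIS-FREE in the laws -/

section AtRecord

variable {ι : Type} [DecidableEq ι]

/-- **★ E1 AT EVERY LEVEL AT THE STAGE-13 WITNESS OF RECORD — HYPOTHESIS-FREE IN THE LAWS** (ANY datum with measurable averaging; `g 0 = g₀ K`; `k ≤ K`): §1 at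
`θ := theta13OfFamily F N eps0OfRecord₁₃ …` with `hres := hasResidualsOfRecord_theta13OfFamily F N eps0OfRecord₁₃`. [cite: Balaban1985UV3, (6) p.257; King1986, (3.10) p.656; Balaban1988Convergent, (3.16) p.268; Balaban1989LargeFieldI, (0.3)–(0.4) p.176 (bookkeeping)] -/
theorem sum_classWeightOfDatum₉_theta13LiveOfRecord_eq_schemeZ (D : FiniteEpsData F (SU N)) (hD : D.AvgMeasurable) (g₀ : ℕ → ℝ) (os : List (ULoop F))
    (p : B12.RunParams) (g : ℕ → ℝ) (hg : g 0 = g₀ p.K) (t : ℝ) (k : ℕ) (hk : k ≤ p.K) :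
    ∑ s : SeqOfRecord F (theta13LiveOfRecord F N).ν (theta13LiveOfRecord F N).τ9.M g p.K k,
        classWeightOfDatum₉ F N (theta13LiveOfRecord F N).toStage9Params D g₀ os p g k t s
      = T4GenFunBounds.schemeZ (D.scheme g₀) os p.K t :=
  sum_classWeightOfDatum₉_liveRepin₁₃_eq_schemeZ F N (theta13OfFamily F N eps0OfRecord₁₃ _ _ _) (hasResidualsOfRecord_theta13OfFamily F N eps0OfRecord₁₃)
    D hD g₀ os p g hg t k hk

/-- **★★ N19's :183 ROAD FOR TWO-SIDED KEYED CLASS-WEIGHT TERM DATA AT THE STAGE-13 WITNESS OF RECORD, EVERY LAW DISCHARGED** (generic datum `D` with measurable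
averaging; class set built in-file): DISPLAYED — `D hD g₀ os`, the two run families with cutoffs and history starts, node U5d's key maps `kA` ∕ `kB`, `0 ≤ l₀`, `0 < vol`,
and THE FOUR SPINE ESTIMATES `h20` ∕ `h21` ∕ `hlt` ∕ `hedge` — nothing else.  §1 at `θ := theta13OfFamily F N eps0OfRecord₁₃ …`, `hres := hasResidualsOfRecord_theta13OfFamily`.
[cite: Balaban1985UV3, (6) p.257; Balaban1989LargeFieldII, Thm 1 + (0.1) pp.355–356; King1986, (3.10) p.656 (bookkeeping)] -/
theorem matching_scheme_of_coreEdge_keyedClassWeights_imageUnion_theta13LiveOfRecord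
    (D : FiniteEpsData F (SU N)) (hD : D.AvgMeasurable) (g₀ : ℕ → ℝ) (os : List (ULoop F)) {K₀ : ℕ} (pA pB : ℕ → B12.RunParams) (gA gB : ℕ → ℕ → ℝ)
    (hKA : ∀ K, (pA K).K = K₀ + K) (hKB : ∀ K, (pB K).K = K₀ + K + 1) (hgA : ∀ K, gA K 0 = g₀ (pA K).K) (hgB : ∀ K, gB K 0 = g₀ (pB K).K)
    (kA : (K : ℕ) → SeqOfRecord F (theta13LiveOfRecord F N).ν (theta13LiveOfRecord F N).τ9.M (gA K) (pA K).K (pA K).K → ι)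
    (kB : (K : ℕ) → SeqOfRecord F (theta13LiveOfRecord F N).ν (theta13LiveOfRecord F N).τ9.M (gB K) (pB K).K (pB K).K → ι)
    {l₀ vol : ℝ} (hl₀ : 0 ≤ l₀) (hvol : 0 < vol) {shA shB : ℕ → ℝ → ι → ℝ} {Bad : ℕ → ℝ → Finset ι} {W Wsh : ℕ → ℝ}
    (h20 : RelWeightBound l₀ (fun K => Finset.univ.image (kA K) ∪ Finset.univ.image (kB K))
      (fun K t x => ∑ s ∈ Finset.univ.filter
          (fun s : SeqOfRecord F (theta13LiveOfRecord F N).ν (theta13LiveOfRecord F N).τ9.M (gA K) (pA K).K (pA K).K => kA K s = x),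
        classWeightOfDatum₉ F N (theta13LiveOfRecord F N).toStage9Params D g₀ os (pA K) (gA K) (pA K).K t s)
      (fun K t x => ∑ s' ∈ Finset.univ.filter
          (fun s' : SeqOfRecord F (theta13LiveOfRecord F N).ν (theta13LiveOfRecord F N).τ9.M (gB K) (pB K).K (pB K).K => kB K s' = x),
        classWeightOfDatum₉ F N (theta13LiveOfRecord F N).toStage9Params D g₀ os (pB K) (gB K) (pB K).K t s') Bad W)
    (h21 : ShellWeightBound l₀ (fun K => Finset.univ.image (kA K) ∪ Finset.univ.image (kB K))
      (fun K t x => ∑ s ∈ Finset.univ.filter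
          (fun s : SeqOfRecord F (theta13LiveOfRecord F N).ν (theta13LiveOfRecord F N).τ9.M (gA K) (pA K).K (pA K).K => kA K s = x),
        classWeightOfDatum₉ F N (theta13LiveOfRecord F N).toStage9Params D g₀ os (pA K) (gA K) (pA K).K t s)
      (fun K t x => ∑ s' ∈ Finset.univ.filter
          (fun s' : SeqOfRecord F (theta13LiveOfRecord F N).ν (theta13LiveOfRecord F N).τ9.M (gB K) (pB K).K (pB K).K => kB K s' = x),
        classWeightOfDatum₉ F N (theta13LiveOfRecord F N).toStage9Params D g₀ os (pB K) (gB K) (pB K).K t s') shA shB Wsh)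
    (hlt : ∀ K, W K + Wsh K < 1)
    (hedge : ∃ δ : ℕ → ℝ, NE7.Core l₀ vol (fun K => Finset.univ.image (kA K) ∪ Finset.univ.image (kB K)) Bad
      (fun K t x => (∑ s ∈ Finset.univ.filter
          (fun s : SeqOfRecord F (theta13LiveOfRecord F N).ν (theta13LiveOfRecord F N).τ9.M (gA K) (pA K).K (pA K).K => kA K s = x),
        classWeightOfDatum₉ F N (theta13LiveOfRecord F N).toStage9Params D g₀ os (pA K) (gA K) (pA K).K t s) - shA K t x)
      (fun K t x => (∑ s' ∈ Finset.univ.filter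
          (fun s' : SeqOfRecord F (theta13LiveOfRecord F N).ν (theta13LiveOfRecord F N).τ9.M (gB K) (pB K).K (pB K).K => kB K s' = x),
        classWeightOfDatum₉ F N (theta13LiveOfRecord F N).toStage9Params D g₀ os (pB K) (gB K) (pB K).K t s') - shB K t x) δ ∧ Summable δ) :
    ∃ δ' : ℕ → ℝ, Summable δ' ∧ MatchingModConstants vol l₀ δ' (T4GenFunBounds.schemeZ (D.scheme g₀) os) :=
  matching_scheme_of_coreEdge_keyedClassWeights_imageUnion_liveRepin₁₃ F N (theta13OfFamily F N eps0OfRecord₁₃ _ _ _)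
    (hasResidualsOfRecord_theta13OfFamily F N eps0OfRecord₁₃) D hD g₀ os pA pB gA gB hKA hKB hgA hgB kA kB hl₀ hvol h20 h21 hlt hedge

/-- **★ E1 AT EVERY LEVEL AT NODE 00's CLOSED v1.7 DATUM OF RECORD** `𝔇ʳᵉᶜ := datumOfRecord₁₃CoPH F N (ofHistoryBlind (ofCured θ₁₃)) (provisos₁₃CoPH_door_theta13LiveOfRecord F N)`
(dag-n11-e's HYPOTHESIS-FREE door proof, `Node00/Record13CoreAtTheta13LiveOfRecord`): `Σ_s classWeightOfDatum₉ θ₁₃.toStage9Params 𝔇ʳᵉᶜ g₀ os p g k t s = schemeZ (𝔇ʳᵉᶜ.scheme g₀)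
os K t` — binders `g₀ os p g hg t k hk` ONLY.  (The :183 road at `𝔇ʳᵉᶜ` is §1's `matching_datumOfRecord₁₃CoPH_liveRepin₁₃_door_of_coreEdge_keyedClassWeights_imageUnion` at
`θ := theta13OfFamily F N eps0OfRecord₁₃ …`, `hres := hasResidualsOfRecord_theta13OfFamily F N eps0OfRecord₁₃`, `h := provisos₁₃CoPH_door_theta13LiveOfRecord F N`.)
[cite: Balaban1985UV3, (6) p.257; King1986, (3.10) p.656; Balaban1989LargeFieldII, Thm 1 + (0.1) pp.355–356; Balaban1988Convergent, (3.24)–(3.25) p.270 (bookkeeping)] -/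
theorem sum_classWeightOfDatum₉_theta13LiveOfRecord_door_eq_schemeZ (g₀ : ℕ → ℝ) (os : List (ULoop F)) (p : B12.RunParams) (g : ℕ → ℝ) (hg : g 0 = g₀ p.K)
    (t : ℝ) (k : ℕ) (hk : k ≤ p.K) :
    ∑ s : SeqOfRecord F (theta13LiveOfRecord F N).ν (theta13LiveOfRecord F N).τ9.M g p.K k,
        classWeightOfDatum₉ F N (theta13LiveOfRecord F N).toStage9Params
          (datumOfRecord₁₃CoPH F N (Stage13HParams.ofHistoryBlind F N (Stage13RParams.ofCured F N (theta13LiveOfRecord F N)))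
            (provisos₁₃CoPH_door_theta13LiveOfRecord F N)) g₀ os p g k t s
      = T4GenFunBounds.schemeZ
          ((datumOfRecord₁₃CoPH F N (Stage13HParams.ofHistoryBlind F N (Stage13RParams.ofCured F N (theta13LiveOfRecord F N)))
            (provisos₁₃CoPH_door_theta13LiveOfRecord F N)).scheme g₀) os p.K t :=
  sum_classWeightOfDatum₉_theta13LiveOfRecord_eq_schemeZ F N _ (isPrintedAveraged_datumOfRecord₁₃CoPH F N _ _).avgMeasurable g₀ os p g hg t k hk

end AtRecord

/-! ## §4 AT dag-n21-c's WINDOWED COLLARED K0⁷ WITNESS `θ₁₅ᶜᶜᴹ(j; γ) = theta13OfThm1CCMW F N j γ ε₀ ε₂₉ B₃ B₃' a₀ a₁` (`Node00/Record13NumericsOfThm1CCMW`; the witness of plan g77's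
LIVE K0⁷ skeleton V16 at `F, N = 2, j = 3`): a member of the all-numerics family (`rfl`), so E1 and the :183 road hold there with NO law binder and NO window ∕ sign hypothesis -/

section AtThm1CCMW

variable (j : ℕ) (γ ε₀ ε₂₉ B₃ B₃' a₀ a₁ : ℝ) {ι : Type} [DecidableEq ι]

/-- **★ E1 AT EVERY LEVEL AT THE WINDOWED COLLARED K0⁷ WITNESS — HYPOTHESIS-FREE IN THE LAWS** (ANY datum with measurable averaging; `g 0 = g₀ K`; `k ≤ K`; no `0 < γ`, no
`0 < ε₀`, no proviso read): §1 at `θ := theta13OfNumerics F N (stage12NumericsOfThm1CCMW F.L j γ ε₀ B₃ B₃' a₀ a₁) ε₂₉ …`, `hres := hasResidualsOfRecord_theta13OfNumerics`.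
[cite: Balaban1985UV3, (6) p.257; King1986, (3.10) p.656; Balaban1988Convergent, (3.16) p.268; Balaban1987RG1, Thm 1 p.255; Balaban1989LargeFieldI, (0.3)–(0.4) p.176 (bookkeeping)] -/
theorem sum_classWeightOfDatum₉_theta13OfThm1CCMW_eq_schemeZ (D : FiniteEpsData F (SU N)) (hD : D.AvgMeasurable) (g₀ : ℕ → ℝ) (os : List (ULoop F))
    (p : B12.RunParams) (g : ℕ → ℝ) (hg : g 0 = g₀ p.K) (t : ℝ) (k : ℕ) (hk : k ≤ p.K) :
    ∑ s : SeqOfRecord F (theta13OfThm1CCMW F N j γ ε₀ ε₂₉ B₃ B₃' a₀ a₁).ν (theta13OfThm1CCMW F N j γ ε₀ ε₂₉ B₃ B₃' a₀ a₁).τ9.M g p.K k,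
        classWeightOfDatum₉ F N (theta13OfThm1CCMW F N j γ ε₀ ε₂₉ B₃ B₃' a₀ a₁).toStage9Params D g₀ os p g k t s
      = T4GenFunBounds.schemeZ (D.scheme g₀) os p.K t :=
  sum_classWeightOfDatum₉_liveRepin₁₃_eq_schemeZ F N (theta13OfNumerics F N (stage12NumericsOfThm1CCMW F.L j γ ε₀ B₃ B₃' a₀ a₁) ε₂₉ _ _ _)
    (hasResidualsOfRecord_theta13OfNumerics F N _ ε₂₉) D hD g₀ os p g hg t k hk

/-- **★★ N19's :183 ROAD FOR TWO-SIDED KEYED CLASS-WEIGHT TERM DATA AT THE WINDOWED COLLARED K0⁷ WITNESS, EVERY LAW DISCHARGED** (generic datum; class set built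
in-file): DISPLAYED — `D hD g₀ os`, run families with cutoffs and history starts, node U5d's key maps, `0 ≤ l₀`, `0 < vol`, THE FOUR SPINE ESTIMATES — nothing else (in
particular no window sign `0 < γ ≤ ½`, no `n.Pos`, no proviso: the laws of the dressed family do not read them). [cite: Balaban1985UV3, (6) p.257; Balaban1989LargeFieldII, Thm 1 + (0.1) pp.355–356; King1986, (3.10) p.656; Balaban1987RG1, Thm 1 p.255 (bookkeeping)] -/
theorem matching_scheme_of_coreEdge_keyedClassWeights_imageUnion_theta13OfThm1CCMW
    (D : FiniteEpsData F (SU N)) (hD : D.AvgMeasurable) (g₀ : ℕ → ℝ) (os : List (ULoop F)) {K₀ : ℕ} (pA pB : ℕ → B12.RunParams) (gA gB : ℕ → ℕ → ℝ)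
    (hKA : ∀ K, (pA K).K = K₀ + K) (hKB : ∀ K, (pB K).K = K₀ + K + 1) (hgA : ∀ K, gA K 0 = g₀ (pA K).K) (hgB : ∀ K, gB K 0 = g₀ (pB K).K)
    (kA : (K : ℕ) → SeqOfRecord F (theta13OfThm1CCMW F N j γ ε₀ ε₂₉ B₃ B₃' a₀ a₁).ν (theta13OfThm1CCMW F N j γ ε₀ ε₂₉ B₃ B₃' a₀ a₁).τ9.M (gA K) (pA K).K (pA K).K → ι)
    (kB : (K : ℕ) → SeqOfRecord F (theta13OfThm1CCMW F N j γ ε₀ ε₂₉ B₃ B₃' a₀ a₁).ν (theta13OfThm1CCMW F N j γ ε₀ ε₂₉ B₃ B₃' a₀ a₁).τ9.M (gB K) (pB K).K (pB K).K → ι)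
    {l₀ vol : ℝ} (hl₀ : 0 ≤ l₀) (hvol : 0 < vol) {shA shB : ℕ → ℝ → ι → ℝ} {Bad : ℕ → ℝ → Finset ι} {W Wsh : ℕ → ℝ}
    (h20 : RelWeightBound l₀ (fun K => Finset.univ.image (kA K) ∪ Finset.univ.image (kB K))
      (fun K t x => ∑ s ∈ Finset.univ.filter (fun s : SeqOfRecord F (theta13OfThm1CCMW F N j γ ε₀ ε₂₉ B₃ B₃' a₀ a₁).ν
            (theta13OfThm1CCMW F N j γ ε₀ ε₂₉ B₃ B₃' a₀ a₁).τ9.M (gA K) (pA K).K (pA K).K => kA K s = x),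
        classWeightOfDatum₉ F N (theta13OfThm1CCMW F N j γ ε₀ ε₂₉ B₃ B₃' a₀ a₁).toStage9Params D g₀ os (pA K) (gA K) (pA K).K t s)
      (fun K t x => ∑ s' ∈ Finset.univ.filter (fun s' : SeqOfRecord F (theta13OfThm1CCMW F N j γ ε₀ ε₂₉ B₃ B₃' a₀ a₁).ν
            (theta13OfThm1CCMW F N j γ ε₀ ε₂₉ B₃ B₃' a₀ a₁).τ9.M (gB K) (pB K).K (pB K).K => kB K s' = x),
        classWeightOfDatum₉ F N (theta13OfThm1CCMW F N j γ ε₀ ε₂₉ B₃ B₃' a₀ a₁).toStage9Params D g₀ os (pB K) (gB K) (pB K).K t s') Bad W)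
    (h21 : ShellWeightBound l₀ (fun K => Finset.univ.image (kA K) ∪ Finset.univ.image (kB K))
      (fun K t x => ∑ s ∈ Finset.univ.filter (fun s : SeqOfRecord F (theta13OfThm1CCMW F N j γ ε₀ ε₂₉ B₃ B₃' a₀ a₁).ν
            (theta13OfThm1CCMW F N j γ ε₀ ε₂₉ B₃ B₃' a₀ a₁).τ9.M (gA K) (pA K).K (pA K).K => kA K s = x),
        classWeightOfDatum₉ F N (theta13OfThm1CCMW F N j γ ε₀ ε₂₉ B₃ B₃' a₀ a₁).toStage9Params D g₀ os (pA K) (gA K) (pA K).K t s)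
      (fun K t x => ∑ s' ∈ Finset.univ.filter (fun s' : SeqOfRecord F (theta13OfThm1CCMW F N j γ ε₀ ε₂₉ B₃ B₃' a₀ a₁).ν
            (theta13OfThm1CCMW F N j γ ε₀ ε₂₉ B₃ B₃' a₀ a₁).τ9.M (gB K) (pB K).K (pB K).K => kB K s' = x),
        classWeightOfDatum₉ F N (theta13OfThm1CCMW F N j γ ε₀ ε₂₉ B₃ B₃' a₀ a₁).toStage9Params D g₀ os (pB K) (gB K) (pB K).K t s') shA shB Wsh)
    (hlt : ∀ K, W K + Wsh K < 1)
    (hedge : ∃ δ : ℕ → ℝ, NE7.Core l₀ vol (fun K => Finset.univ.image (kA K) ∪ Finset.univ.image (kB K)) Bad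
      (fun K t x => (∑ s ∈ Finset.univ.filter (fun s : SeqOfRecord F (theta13OfThm1CCMW F N j γ ε₀ ε₂₉ B₃ B₃' a₀ a₁).ν
            (theta13OfThm1CCMW F N j γ ε₀ ε₂₉ B₃ B₃' a₀ a₁).τ9.M (gA K) (pA K).K (pA K).K => kA K s = x),
        classWeightOfDatum₉ F N (theta13OfThm1CCMW F N j γ ε₀ ε₂₉ B₃ B₃' a₀ a₁).toStage9Params D g₀ os (pA K) (gA K) (pA K).K t s) - shA K t x)
      (fun K t x => (∑ s' ∈ Finset.univ.filter (fun s' : SeqOfRecord F (theta13OfThm1CCMW F N j γ ε₀ ε₂₉ B₃ B₃' a₀ a₁).ν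
            (theta13OfThm1CCMW F N j γ ε₀ ε₂₉ B₃ B₃' a₀ a₁).τ9.M (gB K) (pB K).K (pB K).K => kB K s' = x),
        classWeightOfDatum₉ F N (theta13OfThm1CCMW F N j γ ε₀ ε₂₉ B₃ B₃' a₀ a₁).toStage9Params D g₀ os (pB K) (gB K) (pB K).K t s') - shB K t x) δ ∧ Summable δ) :
    ∃ δ' : ℕ → ℝ, Summable δ' ∧ MatchingModConstants vol l₀ δ' (T4GenFunBounds.schemeZ (D.scheme g₀) os) :=
  matching_scheme_of_coreEdge_keyedClassWeights_imageUnion_liveRepin₁₃ F N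
    (theta13OfNumerics F N (stage12NumericsOfThm1CCMW F.L j γ ε₀ B₃ B₃' a₀ a₁) ε₂₉ _ _ _) (hasResidualsOfRecord_theta13OfNumerics F N _ ε₂₉)
    D hD g₀ os pA pB gA gB hKA hKB hgA hgB kA kB hl₀ hvol h20 h21 hlt hedge

end AtThm1CCMW

end Summit.QuantumFields.YangMills.BalabanUVNodes.N19TargetClassWeightsAtLiveRecord

end
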